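import Literature.NumberTheory.Automorphic.GL2EllipticNormalized
import Literature.NumberTheory.Automorphic.GLnSupercuspTypeHilbertSchmidt
import Literature.MeasureTheory.Group.InvariantQuotientConjugacySumSplit
import HarnessLib

/-!
# The trace formula for `GL₂` modulo its parabolic term, for supercusp-type test functions:
`Σ_j ‖R(Φ) e_j‖² = c⁻¹ κ ( meas(X) Σ_{z ∈ Z(K)} Ψ_A(z) + c_μ Σ_{[γ] ell} vol ∫ Ψ_A + ∫_X K_par dμ )`
(Gelbart, *Automorphic forms on adele groups* (1975), (9.39), Prop. 9.10, Thm. 9.22 (i)–(ii),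
(10.13), (10.15); Jacquet–Langlands (1970), §16)

Topic `NumberTheory/Automorphic`; theorems only (no definition, no named fact, no instance visible
to importers). Assembly of the `GL₂` side of the comparison of trace formulas from bricks of the
tree, for a supercusp-type test function `Φ = η₁ + i η₂` on `GL₂(𝔸_K)` with vanishing unipotent
averages `(H_1)` and `Ψ = Φ ⋆ Φ^*`, `Ψ_A(g) = ∫_{A_G} Ψ(a⁻¹ g) dα`:

* spectral side (`GLnSupercuspTypeHilbertSchmidt`): `Σ'_j ‖R(Φ) e_j‖ₑ² = ofReal(c⁻¹ ∫_X re K_Ψ(x, x) dμ)`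
  over a Hilbert basis of the cusp forms, `K_Ψ(x, x)` real, non-negative and integrable on the
  non-compact `X = GL₂(𝔸_K) ⧸ ℝ_{>0} GL₂(K)`;
* the kernel on the diagonal (`AutomorphicQuotientKernelGeometric`):
  `K_Ψ(x̃, x̃) = κ Σ_{γ ∈ GL₂(K)} Ψ_A(x̃ γ x̃⁻¹)`, the sum converging absolutely at every point
  (`GL2.exists_tsum_enorm_le_of_isCompact`);
* the decomposition of `GL₂(K)` into **central**, **elliptic regular** and the remaining
  (**parabolic**: non-central with reducible characteristic polynomial) elements, and of the kernel
  accordingly (`InvariantQuotientConjugacySumSplit`; Gelbart (9.39));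
* the central part integrates to `μ(X) Σ_{z} Ψ_A(z)` (Prop. 9.10, Thm. 9.22 (i)), the elliptic part
  to `c_μ Σ_{c} vol(G_c ⧸ H_c) ∫_{GL₂(𝔸_K) ⧸ G_c} Ψ_A(y γ_c y⁻¹) d(ν/ν_c)` with the printed volumes,
  absolutely convergent (`GL2EllipticNormalized`, Thm. 9.22 (ii), Lemma 9.9 / Prop. 9.10).

Consequences proved here (`GL2.traceFormula_mod_parabolic`):
**the parabolic kernel `x ↦ Σ_{γ parabolic} Ψ_A(x̃ γ x̃⁻¹)` is integrable on `X`** (as a difference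
of integrable functions — NOT termwise, cf. Gelbart §9.B), and

  `Σ'_j ‖R(Φ) e_j‖ₑ² = ofReal( c⁻¹ re[ κ ( μ(X) Σ_{z ∈ Z(K)} Ψ_A(z)
      + Σ_{c ell} c_μ vol(G_c ⧸ H_c) ∫ Ψ_A(y γ_c y⁻¹) d(ν/ν_c) + ∫_X Σ_{γ par} Ψ_A(x̃ γ x̃⁻¹) dμ ) ] )`.

The only unidentified quantity is the parabolic integral; Gelbart's Thm. 9.22 (iii)–(iv) with
Cor. 9.24 assert that it vanishes when `Φ` satisfies the local cusp condition at two places — this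
(the truncation analysis of §9.B / Jacquet–Langlands §16) is NOT proved here. Part of the inline
(D-0026) decomposition of `Literature.NumberTheory.Automorphic.jacquetLanglands_transfer_exists`.

## References

* S. Gelbart, *Automorphic forms on adele groups*, Ann. of Math. Studies 83 (1975), (9.39),
  Prop. 9.10, Thm. 9.22, Cor. 9.24, (10.13), (10.15) [Gelbart1975].
* H. Jacquet, R. P. Langlands, *Automorphic forms on `GL(2)`*, LNM 114 (1970), §16
  [JacquetLanglands1970].
-/

noncomputable section

open NumberField IsDedekindDomain MeasureTheory Measure Topology
open Literature.MeasureTheory.Group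
open scoped NNReal ENNReal Pointwise MatrixGroups

namespace Literature.NumberTheory.Automorphic

-- the coset spaces carry Borel σ-algebras supplied locally, not the quotient σ-algebra
attribute [-instance] Quotient.instMeasurableSpace QuotientGroup.measurableSpace

section GL2

variable (K : Type) [Field K] [NumberField K]

local notation "𝔸K" => AdeleRing (𝓞 K) K
local notation "M₂" => Matrix (Fin 2) (Fin 2) K
local notation "G₂" => AdelicGroupData.gl 2 K

attribute [local instance] adelicBorel borelSpace_adelic locallyCompactSpace_adelic
  secondCountableTopology_gl_adelic

attribute [local instance] AdelicGroupData.measurableSpaceQuotientForm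
  AdelicGroupData.borelSpaceQuotientForm AdelicGroupData.smulInvariantMeasureQuotientForm
  AdelicGroupData.isFiniteMeasureOnCompactsQuotientForm AdelicGroupData.isFiniteMeasureQuotientForm

/-! ### Elliptic regular rational elements are not central -/

omit [NumberField K] in
/-- A `2 × 2` matrix commuting with the nilpotent `E₀₁` has lower-left entry `0`. [folklore] -/
theorem Matrix.apply_one_zero_eq_zero_of_commute_single {R : Type*} [CommRing R]
    (g : Matrix (Fin 2) (Fin 2) R)
    (h : g * Matrix.of ![![0, 1], ![0, 0]] = Matrix.of ![![0, 1], ![0, 0]] * g) : g 1 0 = 0 := by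
  have h11 := congrFun (congrFun h 1) 1
  simp [Matrix.mul_apply, Fin.sum_univ_two] at h11
  exact h11

/-- **An elliptic regular `γ ∈ GL₂(K)` is not central in `GL₂(𝔸_K)`**: a central element commutes
with the rational unipotent `1 + E₀₁`, hence `γ` commutes with `E₀₁` in `M₂(K)` (injectivity of
`K → 𝔸_K`), so `γ₁₀ = 0`, contradicting `GL2.apply_one_zero_ne_zero_of_irreducible_charpoly`.
[folklore] -/
theorem GL2.map_not_mem_center_of_irreducible_charpoly (γ : GL (Fin 2) K)
    (hirr : Irreducible (Matrix.charpoly (γ : M₂))) :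
    Matrix.GeneralLinearGroup.map (algebraMap K 𝔸K) γ ∉ Subgroup.center (GL (Fin 2) 𝔸K) := by
  intro hc
  -- the rational unipotent `u = 1 + E₀₁`
  set N : M₂ := Matrix.of ![![0, 1], ![0, 0]] with hN
  have hN2 : N * N = 0 := by
    ext i j; fin_cases i <;> fin_cases j <;> simp [hN, Matrix.mul_apply, Fin.sum_univ_two]
  set u : GL (Fin 2) K := ⟨1 + N, 1 - N, by
    rw [mul_sub, add_mul, add_mul, one_mul, one_mul, mul_one, hN2]; abel, by
    rw [sub_mul, mul_add, mul_add, one_mul, one_mul, mul_one, hN2]; abel⟩ with hu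
  have h1 : Matrix.GeneralLinearGroup.map (algebraMap K 𝔸K) γ *
      Matrix.GeneralLinearGroup.map (algebraMap K 𝔸K) u =
      Matrix.GeneralLinearGroup.map (algebraMap K 𝔸K) u *
        Matrix.GeneralLinearGroup.map (algebraMap K 𝔸K) γ :=
    ((Subgroup.mem_center_iff.1 hc) _).symm
  rw [← map_mul, ← map_mul] at h1
  -- injectivity of `GL₂(K) → GL₂(𝔸_K)`
  haveI : Nontrivial 𝔸K :=
    inferInstanceAs (Nontrivial (InfiniteAdeleRing K × FiniteAdeleRing (𝓞 K) K))
  have hinj : Function.Injective (Matrix.GeneralLinearGroup.map (n := Fin 2) (algebraMap K 𝔸K)) := by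
    intro a b hab
    apply Units.ext
    have h := congrArg (fun g : GL (Fin 2) 𝔸K => (g : Matrix (Fin 2) (Fin 2) 𝔸K)) hab
    change (algebraMap K 𝔸K).mapMatrix (a : M₂) = (algebraMap K 𝔸K).mapMatrix (b : M₂) at h
    ext i j
    have hij := congrFun (congrFun h i) j
    simp only [RingHom.mapMatrix_apply, Matrix.map_apply] at hij
    exact (algebraMap K 𝔸K).injective hij
  have h2 : γ * u = u * γ := hinj h1
  have h3 : (γ : M₂) * (1 + N) = (1 + N) * (γ : M₂) := by
    have := congrArg (fun g : GL (Fin 2) K => (g : M₂)) h2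
    simpa [hu, Units.val_mul] using this
  have h4 : (γ : M₂) * N = N * (γ : M₂) := by
    rw [mul_add, add_mul, mul_one, one_mul] at h3
    exact add_left_cancel h3
  exact GL2.apply_one_zero_ne_zero_of_irreducible_charpoly K γ hirr
    (Matrix.apply_one_zero_eq_zero_of_commute_single _ h4)

/-! ### Absolute convergence of the full sum over `GL₂(K)` at every point -/

/-- **`Σ_{γ ∈ GL₂(K)} Φ_A(x̃ γ x̃⁻¹)` converges absolutely at every `x̃`** (the bound of
`GL2.exists_tsum_enorm_le_of_isCompact` on the compact `{x̃}`). [cite: Gelbart1975, (9.20)] -/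
theorem GL2.summable_conj (α : Measure (G₂).center') [α.IsHaarMeasure] [SFinite α]
    (Φ : CompactlySupportedContinuousMap (G₂).Adelic ℂ) (x₀ : (G₂).Adelic) :
    Summable fun γ : ↥((G₂).arithmeticSubgroup : Set (G₂).Adelic) =>
      ∫ a, Φ ((a : (G₂).Adelic)⁻¹ * (x₀ * (γ : (G₂).Adelic) * x₀⁻¹)) ∂α := by
  obtain ⟨B, hBt, hB⟩ := GL2.exists_tsum_enorm_le_of_isCompact K (T := {x₀}) isCompact_singleton α Φ
  have h := hB x₀ (Set.mem_singleton x₀)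
  have hne : ∑' γ : (G₂).arithmeticSubgroup,
      ‖∫ a, Φ ((a : (G₂).Adelic)⁻¹ * (x₀ * (γ : (G₂).Adelic) * x₀⁻¹)) ∂α‖ₑ ≠ ∞ :=
    (lt_of_le_of_lt h hBt.lt_top).ne
  have hsum : Summable fun γ : (G₂).arithmeticSubgroup =>
      ‖∫ a, Φ ((a : (G₂).Adelic)⁻¹ * (x₀ * (γ : (G₂).Adelic) * x₀⁻¹)) ∂α‖₊ :=
    ENNReal.tsum_coe_ne_top_iff_summable.1 hne
  exact (NNReal.summable_coe.2 hsum).of_norm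

/-! ### The trace formula modulo the parabolic term -/

/-- **The trace formula for `GL₂` modulo its parabolic term** (Gelbart (1975), (9.39), Prop. 9.10,
Thm. 9.22 (i)–(ii), (10.13) and (10.15)). Data: an automorphic measure `μ` on
`X = GL₂(𝔸_K) ⧸ ℝ_{>0} GL₂(K)`; a Haar measure `α` on `A_G = ℝ_{>0}` and the constant `κ > 0` with
`ρ_H = κ • ((a, γ) ↦ a γ)_* (α ⊗ counting)` for the Haar measure `ρ_H = quotientSubgroupHaar` of
`L = ℝ_{>0} GL₂(K)` (it exists, `AdelicGroupData.exists_eq_smul_map_mul_prod_count`); a supercusp-type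
test function `Φ = η₁ + i η₂` (`η₁, η₂ ∈ IsTestFunctionGL`) with vanishing unipotent averages
`(H_1)`, and `Ψ ∈ C_c(GL₂(𝔸_K))` with `Ψ = Φ ⋆ Φ^*` (`exists_compactlySupported_mulConv`),
`Ψ_A(g) = ∫_{A_G} Ψ(a⁻¹ g) dα`; a set `𝒞` of elliptic regular conjugacy classes of `GL₂(K)` (each
represented by an element of irreducible characteristic polynomial) with, for `c ∈ 𝒞`, the torus
`G_c = C(γ_c)`, `H_c = L ∩ G_c`, Haar measures `ν_c` on `G_c` and the restricted measures
`ρ_{H,c} = ρ_H|_{H_c}`, `ρ_{F,c}` (`GL2.exists_restricted_haar_elliptic`); a Hilbert basis `(e_j)` of the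
cusp forms `L²_cusp`. Write `Γ = GL₂(K) ≤ GL₂(𝔸_K)`, `S_𝒞 = {γ ∈ Γ : [γ] ∈ 𝒞}`,
`S_Z = Γ ∩ Z(GL₂(𝔸_K))` (the central rational elements), `S_P = (Γ ∖ S_𝒞) ∖ S_Z` (for `𝒞` the set
of ALL elliptic regular classes: the non-central elements with reducible characteristic polynomial,
i.e. the `Γ`-conjugates of non-central elements of `B(K)` — the parabolic classes), and
`c = c_μ = unfoldingConstant L ρ_H μ ν`, `ν = adelicHaar`. (The instance binders on `ρ_H`, `ν` —
right and inversion invariance — are theorems of the tree: `isMulRightInvariant_quotientSubgroupHaar`,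
`isInvInvariant_quotientSubgroupHaar`, `GLn.isMulRightInvariant_of_isHaarMeasure_adelic_holds`.) Then:

0. the central kernel `x ↦ Σ'_{z ∈ S_Z} Ψ_A(x̃ z x̃⁻¹)` is the constant `Σ'_{z ∈ S_Z} Ψ_A(z)`;
1. the "parabolic kernel" `x ↦ Σ'_{γ ∈ S_P} Ψ_A(x̃ γ x̃⁻¹)` is **integrable** on `X` (as
   `κ⁻¹ K_Ψ(x, x)` minus the central and elliptic kernels, all integrable; NOT termwise);
2. `∫_X K_Ψ(x, x) dμ = κ · ( μ(X) Σ'_{z ∈ S_Z} Ψ_A(z)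
      + Σ'_{c ∈ 𝒞} (c_μ vol(G_c ⧸ H_c)) ∫_{GL₂(𝔸_K) ⧸ G_c} Ψ_A(y γ_c y⁻¹) d(ν/ν_c)
      + ∫_X Σ'_{γ ∈ S_P} Ψ_A(x̃ γ x̃⁻¹) dμ )`;
3. `Σ'_j ‖R(Φ) e_j‖ₑ² = ofReal( c_μ⁻¹ · re[ the right-hand side of 2 ] )`.

Assembled from `GLnCuspidalSpectrum.tsum_enorm_sq_integratedOperator_cuspidal_eq_ofReal_integral_diagonal`
(spectral side), `AdelicGroupData.quotientKernel_mk_mk_eq_smul_conjTsum` (the kernel on the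
diagonal), `GL2.summable_conj` (pointwise absolute convergence), the splitting lemmas of
`InvariantQuotientConjugacySumSplit`, the central term (`integral_conjTsum_of_subset_center`) and
the elliptic terms with the printed volumes (`GL2.integral_conjTsum_elliptic_eq_tsum_covol_mul`).
What is NOT proved: the evaluation / vanishing of the parabolic integral (Gelbart Thm. 9.22
(iii)–(iv), Cor. 9.24: truncation). [cite: Gelbart1975, Prop. 9.10, Thm. 9.22 (i)–(ii) and (10.13)] -/
theorem GL2.traceFormula_mod_parabolic
    [∀ γ : (G₂).Adelic, MeasurableSpace ((G₂).Adelic ⧸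
      Subgroup.centralizer ({γ} : Set (G₂).Adelic))]
    [∀ γ : (G₂).Adelic, BorelSpace ((G₂).Adelic ⧸ Subgroup.centralizer ({γ} : Set (G₂).Adelic))]
    [∀ γ : (G₂).Adelic, MeasurableSpace (↥(Subgroup.centralizer ({γ} : Set (G₂).Adelic)) ⧸
      ((G₂).quotientSubgroup ⊓ Subgroup.centralizer ({γ} : Set (G₂).Adelic)).subgroupOf
        (Subgroup.centralizer ({γ} : Set (G₂).Adelic)))]
    [∀ γ : (G₂).Adelic, BorelSpace (↥(Subgroup.centralizer ({γ} : Set (G₂).Adelic)) ⧸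
      ((G₂).quotientSubgroup ⊓ Subgroup.centralizer ({γ} : Set (G₂).Adelic)).subgroupOf
        (Subgroup.centralizer ({γ} : Set (G₂).Adelic)))]
    [hH : IsClosed ((G₂).quotientSubgroup : Set (G₂).Adelic)]
    [hCcl : ∀ γ : (G₂).Adelic, IsClosed ((Subgroup.centralizer ({γ} : Set (G₂).Adelic) :
      Subgroup (G₂).Adelic) : Set (G₂).Adelic)]
    [hqr : (quotientSubgroupHaar 2 K).IsMulRightInvariant]
    [hqi : (quotientSubgroupHaar 2 K).IsInvInvariant]
    [har : (adelicHaar 2 K).IsMulRightInvariant]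
    (μ : Measure (G₂).automorphicQuotient) [(G₂).IsAutomorphicMeasure μ]
    (α : Measure (G₂).center') [α.IsHaarMeasure] [SFinite α] {κ : ℝ≥0}
    (hκ : quotientSubgroupHaar 2 K = κ • Measure.map
      (fun p : (G₂).center' × (G₂).arithmeticSubgroup =>
        (⟨(p.1 : (G₂).Adelic) * p.2, AdelicGroupData.mulMap_mem (G₂) p⟩ : (G₂).quotientSubgroup))
      (α.prod count))
    (Φ : CompactlySupportedContinuousMap (G₂).Adelic ℂ)
    {η₁ η₂ : (G₂).Adelic → ℝ} (hη₁ : IsTestFunctionGL 2 K η₁) (hη₂ : IsTestFunctionGL 2 K η₂)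
    (hΦ : ∀ g, Φ g = η₁ g + η₂ g * Complex.I)
    (hΦ0 : ∀ k, 0 < k → k < 2 →
      ∀ (ν𝔫 : Measure (blockNilpotent 2 k (AdeleRing (𝓞 K) K))) [ν𝔫.IsAddHaarMeasure]
        (p r : (G₂).Adelic), ∫ Y, Φ (p * glUnipotent 2 k K (Multiplicative.ofAdd Y) * r) ∂ν𝔫 = 0)
    (Ψ : CompactlySupportedContinuousMap (G₂).Adelic ℂ)
    (hΨ : ∀ g, Ψ g = mulConv (adelicHaar 2 K) (Φ : (G₂).Adelic → ℂ) (mulStar Φ) g)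
    (𝒞 : Set (ConjClasses (G₂).arithmeticSubgroup))
    (h𝒞 : ∀ c ∈ 𝒞, ∃ g : GL (Fin 2) K, Matrix.GeneralLinearGroup.map (algebraMap K 𝔸K) g =
      ((Quotient.out c : (G₂).arithmeticSubgroup) : (G₂).Adelic) ∧
        Irreducible (Matrix.charpoly (g : M₂)))
    (ρH : ∀ c : 𝒞, Measure ↥((G₂).quotientSubgroup ⊓ Subgroup.centralizer
      ({((Quotient.out (c : ConjClasses (G₂).arithmeticSubgroup) : (G₂).arithmeticSubgroup) :
        (G₂).Adelic)} : Set (G₂).Adelic)))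
    [∀ c, IsHaarMeasure (ρH c)] [∀ c, (ρH c).IsInvInvariant] [∀ c, SFinite (ρH c)]
    (ρF : ∀ c : 𝒞, Measure ↥(((G₂).quotientSubgroup ⊓ Subgroup.centralizer
      ({((Quotient.out (c : ConjClasses (G₂).arithmeticSubgroup) : (G₂).arithmeticSubgroup) :
        (G₂).Adelic)} : Set (G₂).Adelic)).subgroupOf (Subgroup.centralizer
          ({((Quotient.out (c : ConjClasses (G₂).arithmeticSubgroup) : (G₂).arithmeticSubgroup) :
            (G₂).Adelic)} : Set (G₂).Adelic))))
    [∀ c, IsHaarMeasure (ρF c)] [∀ c, (ρF c).IsInvInvariant] [∀ c, SFinite (ρF c)]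
    (νC : ∀ c : 𝒞, Measure ↥(Subgroup.centralizer
      ({((Quotient.out (c : ConjClasses (G₂).arithmeticSubgroup) : (G₂).arithmeticSubgroup) :
        (G₂).Adelic)} : Set (G₂).Adelic)))
    [∀ c, IsHaarMeasure (νC c)] [∀ c, (νC c).IsMulRightInvariant] [∀ c, (νC c).IsInvInvariant]
    [∀ c, SFinite (νC c)]
    (hρH : ∀ c, ρH c = (quotientSubgroupHaar 2 K).comap (Subgroup.inclusion inf_le_left))
    (hρF : ∀ c, ρF c = Measure.map (Subgroup.subgroupOfEquivOfLe inf_le_right).symm (ρH c))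
    {ι : Type*} (b : HilbertBasis ι ℂ (cuspidalSubspace 2 K μ).toSubmodule) :
    -- the three index sets and the averaged test function
    let SC : Set (G₂).Adelic := ((↑) : (G₂).arithmeticSubgroup → (G₂).Adelic) ''
      {γ : (G₂).arithmeticSubgroup | ConjClasses.mk γ ∈ 𝒞}
    let SZ : Set (G₂).Adelic := ((G₂).arithmeticSubgroup : Set (G₂).Adelic) ∩
      (Subgroup.center (G₂).Adelic : Set (G₂).Adelic)
    let ΨA : (G₂).Adelic → ℂ := fun g => ∫ a, Ψ ((a : (G₂).Adelic)⁻¹ * g) ∂α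
    ∃ (hSZ : ∀ ℓ ∈ (G₂).quotientSubgroup, ∀ s ∈ SZ, ℓ * s * ℓ⁻¹ ∈ SZ)
      (hSP : ∀ ℓ ∈ (G₂).quotientSubgroup,
        ∀ s ∈ ((((G₂).arithmeticSubgroup : Set (G₂).Adelic) \ SC) \ SZ),
          ℓ * s * ℓ⁻¹ ∈ ((((G₂).arithmeticSubgroup : Set (G₂).Adelic) \ SC) \ SZ)),
      (conjTsum (G₂).quotientSubgroup SZ hSZ ΨA = fun _ => ∑' s : SZ, ΨA s) ∧
      Integrable (conjTsum (G₂).quotientSubgroup _ hSP ΨA) μ ∧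
      ∫ x, quotientKernel (G₂).quotientSubgroup (quotientSubgroupHaar 2 K) (Ψ : (G₂).Adelic → ℂ)
          x x ∂μ =
        (κ : ℂ) * ((μ.real Set.univ : ℂ) * (∑' s : SZ, ΨA s) +
          (∑' c : 𝒞, ((((unfoldingConstant (G₂).quotientSubgroup (quotientSubgroupHaar 2 K) μ
              (adelicHaar 2 K) : ℝ≥0∞) *
            quotientMeasure (((G₂).quotientSubgroup ⊓ Subgroup.centralizer
              ({((Quotient.out (c : ConjClasses (G₂).arithmeticSubgroup) :
                (G₂).arithmeticSubgroup) : (G₂).Adelic)} : Set (G₂).Adelic)).subgroupOf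
              (Subgroup.centralizer ({((Quotient.out (c : ConjClasses (G₂).arithmeticSubgroup) :
                (G₂).arithmeticSubgroup) : (G₂).Adelic)} : Set (G₂).Adelic))) (ρF c)
              (isClosed_subgroupOf _ _ (hH.inter (hCcl _))) (νC c) Set.univ).toReal : ℝ) : ℂ) *
            ∫ y, descConj
              ((Quotient.out (c : ConjClasses (G₂).arithmeticSubgroup) : (G₂).arithmeticSubgroup) :
                (G₂).Adelic)
              (Subgroup.centralizer ({((Quotient.out (c : ConjClasses (G₂).arithmeticSubgroup) :
                (G₂).arithmeticSubgroup) : (G₂).Adelic)} : Set (G₂).Adelic))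
              (mem_centralizer_singleton_comm _) ΨA y
              ∂(quotientMeasure (Subgroup.centralizer
                ({((Quotient.out (c : ConjClasses (G₂).arithmeticSubgroup) :
                  (G₂).arithmeticSubgroup) : (G₂).Adelic)} : Set (G₂).Adelic)) (νC c) (hCcl _)
                  (adelicHaar 2 K))) +
          ∫ x, conjTsum (G₂).quotientSubgroup _ hSP ΨA x ∂μ) ∧
      ∑' j, ‖((G₂).rightRegular μ).integratedOperator ((G₂).isUnitary_rightRegular μ)
          ((G₂).isStronglyContinuous_rightRegular_holds μ) (adelicHaar 2 K) Φ
          (b j : (G₂).L2 μ)‖ₑ ^ 2 =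
        ENNReal.ofReal (((automorphicUnfoldingConstant 2 K μ (adelicHaar 2 K) : ℝ)⁻¹) *
          ((κ : ℂ) * ((μ.real Set.univ : ℂ) * (∑' s : SZ, ΨA s) +
          (∑' c : 𝒞, ((((unfoldingConstant (G₂).quotientSubgroup (quotientSubgroupHaar 2 K) μ
              (adelicHaar 2 K) : ℝ≥0∞) *
            quotientMeasure (((G₂).quotientSubgroup ⊓ Subgroup.centralizer
              ({((Quotient.out (c : ConjClasses (G₂).arithmeticSubgroup) :
                (G₂).arithmeticSubgroup) : (G₂).Adelic)} : Set (G₂).Adelic)).subgroupOf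
              (Subgroup.centralizer ({((Quotient.out (c : ConjClasses (G₂).arithmeticSubgroup) :
                (G₂).arithmeticSubgroup) : (G₂).Adelic)} : Set (G₂).Adelic))) (ρF c)
              (isClosed_subgroupOf _ _ (hH.inter (hCcl _))) (νC c) Set.univ).toReal : ℝ) : ℂ) *
            ∫ y, descConj
              ((Quotient.out (c : ConjClasses (G₂).arithmeticSubgroup) : (G₂).arithmeticSubgroup) :
                (G₂).Adelic)
              (Subgroup.centralizer ({((Quotient.out (c : ConjClasses (G₂).arithmeticSubgroup) :
                (G₂).arithmeticSubgroup) : (G₂).Adelic)} : Set (G₂).Adelic))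
              (mem_centralizer_singleton_comm _) ΨA y
              ∂(quotientMeasure (Subgroup.centralizer
                ({((Quotient.out (c : ConjClasses (G₂).arithmeticSubgroup) :
                  (G₂).arithmeticSubgroup) : (G₂).Adelic)} : Set (G₂).Adelic)) (νC c) (hCcl _)
                  (adelicHaar 2 K))) +
          ∫ x, conjTsum (G₂).quotientSubgroup _ hSP ΨA x ∂μ)).re) := by
  intro SC SZ ΨA
  classical
  have hdisc : (G₂).IsDiscreteRational := gl_isDiscreteRational_holds 2 K
  haveI : (adelicHaar 2 K).IsInvInvariant := adelicHaar_isInvInvariant 2 K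
  -- the conjugation-stability of the index sets
  have hΓ := AdelicGroupData.conj_mem_arithmeticSubgroup (G₂)
  have hSC : ∀ ℓ ∈ (G₂).quotientSubgroup, ∀ s ∈ SC, ℓ * s * ℓ⁻¹ ∈ SC :=
    conj_mem_of_mk_mem (G₂).arithmeticSubgroup 𝒞 (G₂).quotientSubgroup
      (AdelicGroupData.exists_inv_mul_mem_centralizer_quotientSubgroup (G₂))
  have hSZ : ∀ ℓ ∈ (G₂).quotientSubgroup, ∀ s ∈ SZ, ℓ * s * ℓ⁻¹ ∈ SZ := by
    intro ℓ hℓ s hs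
    have h : ℓ * s * ℓ⁻¹ = s := by
      rw [Subgroup.mem_center_iff.1 hs.2 ℓ, mul_inv_cancel_right]
    rw [h]; exact hs
  have hSCΓ : SC ⊆ ((G₂).arithmeticSubgroup : Set (G₂).Adelic) := by
    rintro _ ⟨γ, -, rfl⟩; exact γ.2
  have hΓC := conj_mem_diff (G₂).quotientSubgroup hΓ hSC
  have hSZsub : SZ ⊆ ((G₂).arithmeticSubgroup : Set (G₂).Adelic) \ SC := by
    intro s hs
    refine ⟨hs.1, ?_⟩
    rintro ⟨γ, hγ, rfl⟩
    obtain ⟨g, hg, hirr⟩ := GL2.exists_eq_map_of_mk_mem K 𝒞 h𝒞 hγ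
    have hnc := GL2.map_not_mem_center_of_irreducible_charpoly K g hirr
    rw [hg] at hnc
    exact hnc hs.2
  have hSP := conj_mem_diff (G₂).quotientSubgroup hΓC hSZ
  refine ⟨hSZ, hSP, ?_⟩
  -- the three partial kernels and the full kernel on the diagonal
  set fC := conjTsum (G₂).quotientSubgroup SC hSC ΨA with hfC
  set fZ := conjTsum (G₂).quotientSubgroup SZ hSZ ΨA with hfZ
  set fP := conjTsum (G₂).quotientSubgroup _ hSP ΨA with hfP
  set Kd : (G₂).automorphicQuotient → ℂ := fun x =>
    quotientKernel (G₂).quotientSubgroup (quotientSubgroupHaar 2 K) (Ψ : (G₂).Adelic → ℂ) x x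
    with hKd
  -- pointwise: `K(x, x) = κ (f_C + f_Z + f_P)(x)`
  have hpt : ∀ x, Kd x = (κ : ℂ) * (fC x + fZ x + fP x) := by
    intro x
    induction x using QuotientGroup.induction_on with
    | H x₀ =>
      have hK := AdelicGroupData.quotientKernel_mk_mk_eq_smul_conjTsum (G₂) hdisc
        (centralRetraction 2 K) (continuous_centralRetraction 2 K) (centralRetraction_mem 2 K)
        (fun a ha => centralRetraction_eq_self 2 K ha) (fun γ hγ => centralRetraction_eq_one 2 K hγ)
        α (quotientSubgroupHaar 2 K) hκ Ψ x₀
      have hsum := GL2.summable_conj K α Ψ x₀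
      have hs1 := conjTsum_eq_conjTsum_add_conjTsum_diff (G₂).quotientSubgroup hSCΓ hΓ hSC ΨA x₀
        hsum
      have hsum2 : Summable fun t : ↥(((G₂).arithmeticSubgroup : Set (G₂).Adelic) \ SC) =>
          ΨA (x₀ * t * x₀⁻¹) :=
        hsum.comp_injective (i := fun t : ↥(((G₂).arithmeticSubgroup : Set (G₂).Adelic) \ SC) =>
          (⟨t, t.2.1⟩ : ↥((G₂).arithmeticSubgroup : Set (G₂).Adelic)))
          (fun a b h => Subtype.ext (congrArg
            (fun t : ↥((G₂).arithmeticSubgroup : Set (G₂).Adelic) => (t : (G₂).Adelic)) h))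
      have hs2 := conjTsum_eq_conjTsum_add_conjTsum_diff (G₂).quotientSubgroup hSZsub hΓC hSZ ΨA
        x₀ hsum2
      change quotientKernel (G₂).quotientSubgroup (quotientSubgroupHaar 2 K) (Ψ : (G₂).Adelic → ℂ)
        (QuotientGroup.mk x₀) (QuotientGroup.mk x₀) = _
      rw [hK, NNReal.smul_def, Complex.real_smul, hs1, hs2]
      simp only [hfC, hfZ, hfP]
      ring
  -- integrability of the pieces
  have hΨf : (Ψ : (G₂).Adelic → ℂ) = mulConv (adelicHaar 2 K) (Φ : (G₂).Adelic → ℂ) (mulStar Φ) :=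
    funext hΨ
  have hcpos := automorphicUnfoldingConstant_pos 2 K μ (adelicHaar 2 K)
  have hc : unfoldingConstant (G₂).quotientSubgroup (quotientSubgroupHaar 2 K) μ (adelicHaar 2 K) ≠ 0 :=
    hcpos.ne'
  have hKre : Integrable (fun x => (Kd x).re) μ := by
    have h := GLnCuspidalSpectrum.integrable_re_quotientKernel_mulConv_mulStar_diagonal μ Φ hη₁ hη₂
      hΦ hΦ0
    rw [← hΨf] at h
    exact h
  have hKreal : ∀ x, Kd x = (((Kd x).re : ℝ) : ℂ) := by
    intro x
    have h := quotientKernel_mulConv_mulStar_diag_eq (G₂).quotientSubgroup (quotientSubgroupHaar 2 K)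
      μ (adelicHaar 2 K) (𝕜 := ℂ) hc (f := (Φ : (G₂).Adelic → ℂ)) Φ.continuous Φ.hasCompactSupport x
    rw [← hΨf] at h
    obtain ⟨r, hr⟩ : ∃ r : ℝ, Kd x = (r : ℂ) := ⟨_, h⟩
    rw [hr, Complex.ofReal_re]
  have hKint : Integrable Kd μ := by
    have h : Kd = fun x => (((Kd x).re : ℝ) : ℂ) := funext hKreal
    rw [h]
    exact hKre.ofReal
  -- the elliptic part (printed volumes) and the central part
  obtain ⟨hCint0, -, -, hCeq0⟩ := GL2.integral_conjTsum_elliptic_eq_tsum_covol_mul K μ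
    (adelicHaar 2 K) (quotientSubgroupHaar 2 K) 𝒞 h𝒞 ρH ρF νC hρH hρF α Ψ
  have hCint : Integrable fC μ := hCint0
  have hCeq : ∫ x, fC x ∂μ = _ := hCeq0
  have hZsub : SZ ⊆ Subgroup.center (G₂).Adelic := fun s hs => hs.2
  have hZint : Integrable fZ μ :=
    integrable_conjTsum_of_subset_center (G₂).quotientSubgroup hSZ hZsub μ ΨA
  have hZeq : ∫ x, fZ x ∂μ = (μ.real Set.univ : ℂ) * ∑' s : SZ, ΨA s := by
    have h : ∫ x, fZ x ∂μ = (μ Set.univ).toReal • ∑' s : SZ, ΨA s :=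
      integral_conjTsum_of_subset_center (G₂).quotientSubgroup hSZ hZsub μ ΨA
    rw [h, Complex.real_smul]
    rfl
  -- the parabolic part is integrable as a difference
  have hκ0 : (κ : ℂ) ≠ 0 := by
    have hρ0 : quotientSubgroupHaar 2 K ≠ 0 := fun h => by
      have h2 : 0 < quotientSubgroupHaar 2 K Set.univ :=
        isOpen_univ.measure_pos (quotientSubgroupHaar 2 K) ⟨1, trivial⟩
      rw [h] at h2; exact lt_irrefl _ h2
    have hk : κ ≠ 0 := by
      rintro rfl
      exact hρ0 (by rw [hκ, zero_smul])
    exact_mod_cast hk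
  have hPeq_fun : fP = fun x => (κ : ℂ)⁻¹ * Kd x - fC x - fZ x := by
    funext x
    rw [hpt x, ← mul_assoc, inv_mul_cancel₀ hκ0, one_mul]
    ring
  have hPint : Integrable fP μ := by
    rw [hPeq_fun]
    exact ((hKint.const_mul _).sub hCint).sub hZint
  -- the integral of the kernel
  have hA : ∫ x, (fC x + fZ x + fP x) ∂μ = ∫ x, fC x ∂μ + ∫ x, fZ x ∂μ + ∫ x, fP x ∂μ := by
    have e1 : ∫ x, (fC x + fZ x + fP x) ∂μ = ∫ x, (fC x + fZ x) ∂μ + ∫ x, fP x ∂μ :=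
      integral_add (hCint.add hZint) hPint
    have e2 : ∫ x, (fC x + fZ x) ∂μ = ∫ x, fC x ∂μ + ∫ x, fZ x ∂μ := integral_add hCint hZint
    rw [e1, e2]
  have h1 : ∫ x, Kd x ∂μ = (κ : ℂ) * (∫ x, fZ x ∂μ + ∫ x, fC x ∂μ + ∫ x, fP x ∂μ) := by
    rw [integral_congr_ae (Filter.Eventually.of_forall hpt), integral_const_mul, hA]
    ring
  have h1' := h1
  rw [hZeq, hCeq] at h1'
  refine ⟨conjTsum_of_subset_center (G₂).quotientSubgroup hSZ hZsub ΨA, hPint, h1', ?_⟩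
  -- the Hilbert–Schmidt sum
  have hHS := GLnCuspidalSpectrum.tsum_enorm_sq_integratedOperator_cuspidal_eq_ofReal_integral_diagonal
    μ Φ hη₁ hη₂ hΦ hΦ0 b
  rw [hHS, ← hΨf]
  congr 2
  have h2 : ∫ x, (Kd x).re ∂μ = (∫ x, Kd x ∂μ).re := integral_re hKint
  change ∫ x, (Kd x).re ∂μ = _
  rw [h2, h1']

end GL2

end Literature.NumberTheory.Automorphic
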